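import Literature.NumberTheory.Weil1964.AdelicDoublingFrameRationalInvariance
import Literature.NumberTheory.Automorphic.UnitaryDualPairDoubledDiagonalThetaInvariance
import Literature.NumberTheory.Weil1965.ThetaIntegralOrbitFunctionalUnitary
import Summits.HodgeConjecture.HodgeConjecture.Theorems.H413E2SWEisStructure
import HarnessLib

/-!
# H413 · E-2 · SW2 (iii) — THE (INV-E″) STRUCTURE LETTER: `E″ = I□ − κ₀·E` is invariant under the rational points of the
# doubled `W`-member, read in the geometric frame as `(EI − κ₀ • EE) ∘ ω(r⁻¹) = EI − κ₀ • EE`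

Cell `hodgecm-mathlib`, floor 0, programme P4, engine E-2, crux H413 (`stmt-HodgeConjecture-24833`, `--supports`); child line
`Cruxes/H413/Lines/F0_E2SiegelWeilWeilRange.lean` ED. 8, open stub `stub_SW2iii_siegelWeil` (the Siegel–Weil identity for the doubled
pair); row (INV-E″) of the sheets `F0/P4/SW2c-BOUND-ASSEMBLY.v1` (F0P4-p07) §B and `F0/P4/F0P2a-p08/SW2-ICLOSE-ASSEMBLY.v0` §1 (INV-δ);
seat F0P4-p02 (g4), E-2 lead lineage, 2026-08-31.  PROOF lane: theorems only, no definition, no notation, no `sorry`; imports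
`Literature` only (a `Theorems` file never imports a `Lines` file, so the child's carriers `actRat`, `ratDoubledW`, `stabDiagRat`, `ev0`,
`vDiagLift`, `doubledThetaIntegral`, `eis` appear UNFOLDED, exactly as in ★ `SiegelEisensteinRationalInvariance` and
★ `UnitaryDualPairDoubledDiagonalThetaInvariance`).  HC_CM is proved only modulo the printed citations until rung 0 closes; nothing
here is about Hodge classes.

THE MATHEMATICS ([Weil1965] n° 41 and n° 51, «`E″ = E′ − E`»).  Both the doubled theta integral `I□(Ψ) = ∫_{[U(J_V)]} Θ(ω□(S̃(ι(ξ̃⁻¹ ⊗ 1)))Ψ) dν`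
and the Siegel–Eisenstein coset sum `E(Ψ) = Σ_{q ∈ IW(F)/PW(F)} ev₀(r_F(q̃)⁻¹ Ψ)` are invariant under Weil's `r_F(γ)`, `γ ∈ IW(F)` the rational
points of the doubled `W`-member: the theta half is ★ `integral_thetaDistLM_omega_doublingLift_omega_ratThetaLiftCont` (F0P4-p02 (g3): the
`V`-diagonal doubling lift commutes ON THE NOSE with `r_F` on `IW(F)`, and `Θ` is `r_F`-rigid [Weil1964, n° 41 Thm 6]); the Eisenstein
half is ★ `SiegelEisenstein.tsum_quotient_act_eq` (A-p10: `γ` permutes the cosets) fed the Siegel–Eisenstein carrier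
★ `omega_doublingDeltaLift_omega_ratThetaLiftCont_apply_zero` ([Weil1965, n° 39 (30)]: `ev₀` is `PW(F)`-invariant).  Hence every difference
`D_κ := I□ − κ·E` is `IW(F)`-invariant (§1).  The BOUND and I-CLOSE assemblies read these functionals in B-p10's GEOMETRIC FRAME
`Ψ ↦ Ψ♮ = t(C₀)(ω(r_F δ)Ψ)` (★ `geomFrame`), through the structure identities `I□ Ψ = κ₀·Ψ♮(0) + EI(Ψ♮)`
(★ `doubledThetaIntegral_eq_measure_mul_apply_zero_add_thetaOrbitFunctional`, `EI = thetaOrbitFunctional ν`, `κ₀ = ν(univ)`) and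
`E Ψ = Ψ♮(0) + EE(Ψ♮)` (the (E_X)/(T1) letter of F0P4-p06, `EE = adelicSiegelFunctionalC …`; kept here as the HYPOTHESIS `hE` in that
shape): BOTH rank-0 terms cancel in `E″ := EI − κ₀ • EE`, so `E″(Ψ♮) = I□ Ψ − κ₀·E Ψ`.  With A-p12's frame pair `u₀` (`ω(u₀) = t(C₀)`,
hypothesis `hu₀` verbatim from ★-track `AdelicDoublingGeometricFrameBorelMp`) one has `Ψ♮ = ω(u₀ · r_F δ)Ψ`, the frame is onto, and for
`r := u₀ · r_F(δ γ δ⁻¹) · u₀⁻¹` (the junction's lift of the `δ♮`-conjugate of `γ`) `ω(r⁻¹) Ψ♮ = (ω(r_F γ⁻¹) Ψ)♮` — the generic frame algebra,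
the Eisenstein half and the abstract frame transfer are ★ `Weil1964/AdelicDoublingFrameRationalInvariance` (namespace `…Weil1964.DoublingFrame`);
therefore `E″ ∘ ω(r⁻¹) = E″` (§2) — the third conjunct of the `hINV` binder of
`Theorems/H413E2SWBorelBoundNarrowC.exists_borelBound_of_lemma20_of_dominated`, token for token.

* §1 `doubledThetaIntegral_omega_ratThetaLiftCont` (★ p808943 in the `iotaV` spelling of ★ `ThetaIntegralOrbitFunctionalUnitary`) and
  `sub_mul_tsum_eisTerm_omega_ratThetaLiftCont` — `I□(ω(r_F γ)Ψ) − κ·E(ω(r_F γ)Ψ) = I□ Ψ − κ·E Ψ` for `γ ∈ H`, every `κ`.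
* §2 THE LETTER `sub_smul_comp_omega_inv_conj_eq` (structure hypotheses `hI`, `hE` as binders) and
  `thetaOrbitFunctional_sub_smul_comp_omega_inv_conj_eq` (theta side DISCHARGED at `EI := thetaOrbitFunctional ν`, `κ₀ := ν(univ)`; only the
  (E_X)/(T1) letter `hE` remains a binder).
* §3 `exists_witness_of_mem_comap_range` — the hypothesis `hH` for the child's `IW = ratDoubledW`, unfolded (the hypothesis `hP` for the
  child's `PW = stabDiagRat` is ★ `DoublingFrame.mem_siegelParabolicPi_of_mem_comap_conj`).
* §4 (ED. 2) `thetaOrbitFunctional_sub_smul_adelicSiegelFunctionalC_comp_omega_inv_conj_eq` — THE LETTER WITH NO STRUCTURE BINDER: `hE` discharged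
  by ★ `E2SWEisStructure.eis_eq_geomFrame_zero_add_adelicSiegelFunctionalC` (F0P4-p06, CM/totally-real, `2 < N`, Tamagawa `νX`, condition (B) `hB`)
  at `EE := adelicSiegelFunctionalC νX q_{C₀} … hB`, `H := IW(F)`, `P := PW(F)` (the child's subgroups, unfolded as there).

References: A. Weil, *Sur la formule de Siegel dans la théorie des groupes classiques*, Acta Math. 113 (1965), n° 39 (30) p. 57,
n° 41, n° 51–52 Thm 5 pp. 75–77 [Weil1965]; A. Weil, *Sur certains groupes d'opérateurs unitaires*, Acta Math. 111 (1964), Chap. I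
n° 13 p. 160, Chap. III n° 40–41 Thm 6 p. 193 [Weil1964]; S. Kudla, Israel J. Math. 87 (1994), §3 [Kudla1994]; J.-S. Li, J. reine
angew. Math. 428 (1992), p. 181, (24) p. 184 [Li1992]; S. Gelbart, I. Piatetski-Shapiro, S. Rallis, LNM 1254 (1987), Part A §2
[GelbartPiatetskishapiroRallis1987].
-/

set_option autoImplicit false
-- the cell's `Summit.HodgeConjecture.HodgeConjecture.…` namespace repeats the summit name by design (D-0017 layout)
set_option linter.dupNamespace false

noncomputable section

open _root_.MeasureTheory NumberField
open Literature.RepresentationTheory.HeisenbergGroup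
open Literature.NumberTheory.Weil1964 Literature.NumberTheory.Weil1964.DoublingFrame
open Literature.NumberTheory.Weil1965 Literature.NumberTheory.Weil1965.UnitaryDoubling
open Literature.NumberTheory.Automorphic
open Literature.NumberTheory.GelbartRogawski1991 Literature.NumberTheory.GelbartRogawski1991.UnitaryDualPair

namespace Summit.HodgeConjecture.HodgeConjecture.Cruxes.H413.E2SWEInvariance

/-! ## §1 The theta half in the `ι_V` spelling, and the invariant differences `I□ − κ·E` -/

section DualPair

variable (F E : Type) [Field F] [NumberField F] [Field E] [NumberField E] [Algebra F E] [Algebra.IsQuadraticExtension F E]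
  (c : E ≃ₐ[F] E) {δ : E} (hcδ : c δ = -δ) (hδ : δ ≠ 0) {d : F} (hd : δ * δ = algebraMap F E d)
  (N : ℕ) {n : ℕ} (e : Fin N × Fin 1 ≃ Fin n)
  (TV : Matrix (Fin N) (Fin N) F) (hV : TV.IsSymm) (hVd : IsUnit TV.det)
  (TW : Matrix (Fin 1) (Fin 1) F) (hW : TW.IsSymm) (hWd : IsUnit TW.det)
  {TW2 : Matrix (Fin (1 + 1)) (Fin (1 + 1)) F} (hW2 : TW2.IsSymm) (hTW2 : TW2 = UnitaryGroup.finSum 1 1 TW (-TW))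
  (H P : Subgroup (Matrix.symplecticGroup (Fin (n + n)) F))
  (hH : ∀ γ ∈ H, ∃ w : UnitaryGroup.rational F E c (1 + 1) (TW2.map (algebraMap F E)),
    ((toSp F E c N (1 + 1)
          (((Equiv.prodCongr (Equiv.refl (Fin N)) finSumFinEquiv.symm).trans (Equiv.prodSumDistrib (Fin N) (Fin 1) (Fin 1))).trans
            ((Equiv.sumCongr e e).trans finSumFinEquiv))
          (TV.map (algebraMap F E)) (TW2.map (algebraMap F E)) hcδ hδ hd hV hW2 rfl rfl
          (UnitaryGroup.adelicInr F E c N (1 + 1) (TV.map (algebraMap F E)) (TW2.map (algebraMap F E))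
            (UnitaryGroup.toAdelic F E c (1 + 1) (TW2.map (algebraMap F E)) w)) :
          symplecticGroup (polar (adelicForm F (Fin (n + n))
            (adelicGram F
              (((Equiv.prodCongr (Equiv.refl (Fin N)) finSumFinEquiv.symm).trans (Equiv.prodSumDistrib (Fin N) (Fin 1) (Fin 1))).trans
                ((Equiv.sumCongr e e).trans finSumFinEquiv)) TV TW2)))) :
        ((Fin (n + n) → AdeleRing (𝓞 F) F) × (Fin (n + n) → AdeleRing (𝓞 F) F)) ≃ₗ[AdeleRing (𝓞 F) F]
          ((Fin (n + n) → AdeleRing (𝓞 F) F) × (Fin (n + n) → AdeleRing (𝓞 F) F))) =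
      ((ratSp F (doubledGramFin F (adelicGram F e TV TW))
          (isUnit_det_doubledGramFin F _ (isUnit_det_adelicGram F e hVd hWd)) γ :
          symplecticGroup (polar (adelicForm F (Fin (n + n)) (doubledGramFin F (adelicGram F e TV TW))))) :
        ((Fin (n + n) → AdeleRing (𝓞 F) F) × (Fin (n + n) → AdeleRing (𝓞 F) F)) ≃ₗ[AdeleRing (𝓞 F) F]
          ((Fin (n + n) → AdeleRing (𝓞 F) F) × (Fin (n + n) → AdeleRing (𝓞 F) F))))
  (hP : ∀ p ∈ P, ratSp F (doubledGramFin F (adelicGram F e TV TW)) (isUnit_det_doubledGramFin F _ (isUnit_det_adelicGram F e hVd hWd))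
      (doublingDeltaRat F * p * (doublingDeltaRat F)⁻¹) ∈ siegelParabolicPi (doubledGramFin F (adelicGram F e TV TW)))
  [MeasurableSpace (UnitaryGroup.adelic F E c N (TV.map (algebraMap F E)) ⧸ (UnitaryGroup.toAdelic F E c N (TV.map (algebraMap F E))).range)]
  (ν : Measure (UnitaryGroup.adelic F E c N (TV.map (algebraMap F E)) ⧸ (UnitaryGroup.toAdelic F E c N (TV.map (algebraMap F E))).range))

include hTW2 hH in
/-- **THE THETA HALF** `I□(ω(r_F γ)Ψ) = I□(Ψ)` for `γ ∈ H` (`hH`: every `γ ∈ H` is `ι_{eD}(1 ⊗ w)` for a rational `w` — the child's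
`ratDoubledW`, see `exists_witness_of_mem_comap_range`), with `I□(Ψ) = ∫_{[U(J_V)]} Θ(ω□((S̃ ∘ ι_V)(ξ̃⁻¹))Ψ) dν` spelled through
★ `iotaV` as in ★ `doubledThetaIntegral_eq_measure_mul_apply_zero_add_thetaOrbitFunctional` — ★ p808943
`integral_thetaDistLM_omega_doublingLift_omega_ratThetaLiftCont`. [cite: Weil1965, n° 52 Thm 5] [cite: Weil1964, Chap. III n° 41 Thm 6 p. 193] -/
theorem doubledThetaIntegral_omega_ratThetaLiftCont {γ : Matrix.symplecticGroup (Fin (n + n)) F} (hγ : γ ∈ H)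
    (Ψ : piSchwartzBruhat F (Fin (n + n))) :
    ∫ ξ, thetaDistLM F (Fin (n + n))
        (adelicMpCont.omega F (Fin (n + n)) (doubledGramFin F (adelicGram F e TV TW))
          (((doublingLift F (adelicGram F e TV TW) (isUnit_det_adelicGram F e hVd hWd)).comp
              (iotaV F E c hcδ hδ hd N e TV hV TW hW)) (Quotient.out ξ)⁻¹)
          (adelicMpCont.omega F (Fin (n + n)) (doubledGramFin F (adelicGram F e TV TW))
            (ratThetaLiftCont F (doubledGramFin F (adelicGram F e TV TW))
              (isUnit_det_doubledGramFin F _ (isUnit_det_adelicGram F e hVd hWd)) γ) Ψ)) ∂ν =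
      ∫ ξ, thetaDistLM F (Fin (n + n))
        (adelicMpCont.omega F (Fin (n + n)) (doubledGramFin F (adelicGram F e TV TW))
          (((doublingLift F (adelicGram F e TV TW) (isUnit_det_adelicGram F e hVd hWd)).comp
              (iotaV F E c hcδ hδ hd N e TV hV TW hW)) (Quotient.out ξ)⁻¹) Ψ) ∂ν := by
  -- `iotaV = toSp ∘ adelicInl` is definitional (★ `iotaV_eq` is `rfl`); term-mode `Exists.elim` (no `obtain`: `rcases` on these
  -- operator-valued equations exhausts the heartbeat budget in `isDefEq`)
  exact (hH γ hγ).elim fun w hγw =>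
    UnitaryGroup.integral_thetaDistLM_omega_doublingLift_omega_ratThetaLiftCont F E c hcδ hδ hd N e
      hV hW hW2 hVd hWd hTW2 ν γ w hγw Ψ

include hTW2 hH hP in
/-- **`D_κ := I□ − κ·E` IS `H`-INVARIANT**: `I□(ω(r_F γ)Ψ) − κ·E(ω(r_F γ)Ψ) = I□(Ψ) − κ·E(Ψ)` for every `γ ∈ H`, EVERY `κ : ℂ` and every
`Ψ` (no summability used: both Eisenstein sums are reindexed along the permutation `q ↦ γ⁻¹ • q`). [cite: Weil1965, n° 41 and n° 51] -/
theorem sub_mul_tsum_eisTerm_omega_ratThetaLiftCont (κ : ℂ) {γ : Matrix.symplecticGroup (Fin (n + n)) F} (hγ : γ ∈ H)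
    (Ψ : piSchwartzBruhat F (Fin (n + n))) :
    (∫ ξ, thetaDistLM F (Fin (n + n))
        (adelicMpCont.omega F (Fin (n + n)) (doubledGramFin F (adelicGram F e TV TW))
          (((doublingLift F (adelicGram F e TV TW) (isUnit_det_adelicGram F e hVd hWd)).comp
              (iotaV F E c hcδ hδ hd N e TV hV TW hW)) (Quotient.out ξ)⁻¹)
          (adelicMpCont.omega F (Fin (n + n)) (doubledGramFin F (adelicGram F e TV TW))
            (ratThetaLiftCont F (doubledGramFin F (adelicGram F e TV TW))
              (isUnit_det_doubledGramFin F _ (isUnit_det_adelicGram F e hVd hWd)) γ) Ψ)) ∂ν) -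
      κ * ∑' q : H ⧸ P.subgroupOf H,
        ((adelicMpCont.omega F (Fin (n + n)) (doubledGramFin F (adelicGram F e TV TW))
            (doublingDeltaLift F (adelicGram F e TV TW) (isUnit_det_adelicGram F e hVd hWd))
            (adelicMpCont.omega F (Fin (n + n)) (doubledGramFin F (adelicGram F e TV TW))
              (ratThetaLiftCont F (doubledGramFin F (adelicGram F e TV TW))
                (isUnit_det_doubledGramFin F _ (isUnit_det_adelicGram F e hVd hWd))
                ((Quotient.out q : H) : Matrix.symplecticGroup (Fin (n + n)) F)⁻¹)
              (adelicMpCont.omega F (Fin (n + n)) (doubledGramFin F (adelicGram F e TV TW))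
                (ratThetaLiftCont F (doubledGramFin F (adelicGram F e TV TW))
                  (isUnit_det_doubledGramFin F _ (isUnit_det_adelicGram F e hVd hWd)) γ) Ψ)) :
            piSchwartzBruhat F (Fin (n + n))) : (Fin (n + n) → AdeleRing (𝓞 F) F) → ℂ) 0 =
    (∫ ξ, thetaDistLM F (Fin (n + n))
        (adelicMpCont.omega F (Fin (n + n)) (doubledGramFin F (adelicGram F e TV TW))
          (((doublingLift F (adelicGram F e TV TW) (isUnit_det_adelicGram F e hVd hWd)).comp
              (iotaV F E c hcδ hδ hd N e TV hV TW hW)) (Quotient.out ξ)⁻¹) Ψ) ∂ν) -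
      κ * ∑' q : H ⧸ P.subgroupOf H,
        ((adelicMpCont.omega F (Fin (n + n)) (doubledGramFin F (adelicGram F e TV TW))
            (doublingDeltaLift F (adelicGram F e TV TW) (isUnit_det_adelicGram F e hVd hWd))
            (adelicMpCont.omega F (Fin (n + n)) (doubledGramFin F (adelicGram F e TV TW))
              (ratThetaLiftCont F (doubledGramFin F (adelicGram F e TV TW))
                (isUnit_det_doubledGramFin F _ (isUnit_det_adelicGram F e hVd hWd))
                ((Quotient.out q : H) : Matrix.symplecticGroup (Fin (n + n)) F)⁻¹) Ψ) :
            piSchwartzBruhat F (Fin (n + n))) : (Fin (n + n) → AdeleRing (𝓞 F) F) → ℂ) 0 := by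
  exact congrArg₂ (fun a b : ℂ => a - κ * b)
    (doubledThetaIntegral_omega_ratThetaLiftCont F E c hcδ hδ hd N e TV hV hVd TW hW hWd hW2 hTW2 H hH ν hγ Ψ)
    (tsum_eisTerm_omega_ratThetaLiftCont F (adelicGram F e TV TW) (isUnit_det_adelicGram F e hVd hWd) H P hP hγ Ψ)

/-! ## §2 THE LETTER: `(EI − κ₀ • EE) ∘ ω(r⁻¹) = EI − κ₀ • EE` for `r = u₀ · r_F(δ γ δ⁻¹) · u₀⁻¹`, `γ ∈ IW(F)` -/

include hTW2 hH hP in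
/-- **THE (INV-E″) LETTER with the two invariances DISCHARGED**: for `γ ∈ H` (the rational points of the doubled `W`-member) and
`r := u₀ · r_F(δ γ δ⁻¹) · u₀⁻¹`, `(EI − κ₀ • EE) ∘ ω(r⁻¹) = EI − κ₀ • EE` whenever `I□ Ψ = κ₀·Ψ♮(0) + EI(Ψ♮)` and
`E Ψ = Ψ♮(0) + EE(Ψ♮)` (the (Î)/(E_X) structure letters: ★ B-p10 at `EI := thetaOrbitFunctional ν`, `κ₀ := ν(univ)`; F0P4-p06 at
`EE := adelicSiegelFunctionalC …`) — the third conjunct of the `hINV` binder of `exists_borelBound_of_lemma20_of_dominated`.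
[cite: Weil1965, n° 41 and n° 51–52 Thm 5] [cite: Weil1964, Chap. III n° 41 Thm 6 p. 193] -/
theorem sub_smul_comp_omega_inv_conj_eq
    (u₀ : adelicMpCont F (Fin (n + n)) (doubledGramFin F (adelicGram F e TV TW)))
    (hu₀ : ∀ Φ : piSchwartzBruhat F (Fin (n + n)),
      ((adelicMpCont.omega F (Fin (n + n)) (doubledGramFin F (adelicGram F e TV TW)) u₀ Φ : piSchwartzBruhat F (Fin (n + n))) :
          (Fin (n + n) → AdeleRing (𝓞 F) F) → ℂ) =
        chirp F (ratMatrix F (frameHalfRat F)) (Φ : (Fin (n + n) → AdeleRing (𝓞 F) F) → ℂ))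
    {γ : Matrix.symplecticGroup (Fin (n + n)) F} (hγ : γ ∈ H)
    (EI EE : piSchwartzBruhat F (Fin (n + n)) →ₗ[ℂ] ℂ) (κ₀ : ℂ)
    (hI : ∀ Ψ : piSchwartzBruhat F (Fin (n + n)),
      ∫ ξ, thetaDistLM F (Fin (n + n))
          (adelicMpCont.omega F (Fin (n + n)) (doubledGramFin F (adelicGram F e TV TW))
            (((doublingLift F (adelicGram F e TV TW) (isUnit_det_adelicGram F e hVd hWd)).comp
                (iotaV F E c hcδ hδ hd N e TV hV TW hW)) (Quotient.out ξ)⁻¹) Ψ) ∂ν =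
        κ₀ * ((geomFrame F (adelicGram F e TV TW) (isUnit_det_adelicGram F e hVd hWd) Ψ : piSchwartzBruhat F (Fin (n + n))) :
            (Fin (n + n) → AdeleRing (𝓞 F) F) → ℂ) 0 +
          EI (geomFrame F (adelicGram F e TV TW) (isUnit_det_adelicGram F e hVd hWd) Ψ))
    (hE : ∀ Ψ : piSchwartzBruhat F (Fin (n + n)),
      ∑' q : H ⧸ P.subgroupOf H,
        ((adelicMpCont.omega F (Fin (n + n)) (doubledGramFin F (adelicGram F e TV TW))
            (doublingDeltaLift F (adelicGram F e TV TW) (isUnit_det_adelicGram F e hVd hWd))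
            (adelicMpCont.omega F (Fin (n + n)) (doubledGramFin F (adelicGram F e TV TW))
              (ratThetaLiftCont F (doubledGramFin F (adelicGram F e TV TW))
                (isUnit_det_doubledGramFin F _ (isUnit_det_adelicGram F e hVd hWd))
                ((Quotient.out q : H) : Matrix.symplecticGroup (Fin (n + n)) F)⁻¹) Ψ) :
            piSchwartzBruhat F (Fin (n + n))) : (Fin (n + n) → AdeleRing (𝓞 F) F) → ℂ) 0 =
        ((geomFrame F (adelicGram F e TV TW) (isUnit_det_adelicGram F e hVd hWd) Ψ : piSchwartzBruhat F (Fin (n + n))) :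
            (Fin (n + n) → AdeleRing (𝓞 F) F) → ℂ) 0 +
          EE (geomFrame F (adelicGram F e TV TW) (isUnit_det_adelicGram F e hVd hWd) Ψ)) :
    (EI - κ₀ • EE) ∘ₗ adelicMpCont.omega F (Fin (n + n)) (doubledGramFin F (adelicGram F e TV TW))
        (u₀ * ratThetaLiftCont F (doubledGramFin F (adelicGram F e TV TW))
            (isUnit_det_doubledGramFin F _ (isUnit_det_adelicGram F e hVd hWd))
            (doublingDeltaRat F * γ * (doublingDeltaRat F)⁻¹) * u₀⁻¹)⁻¹ =
      EI - κ₀ • EE :=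
  sub_smul_comp_omega_inv_conj_eq_of_frame F (adelicGram F e TV TW) (isUnit_det_adelicGram F e hVd hWd) u₀ hu₀ γ _ _
    (fun Ψ => doubledThetaIntegral_omega_ratThetaLiftCont F E c hcδ hδ hd N e TV hV hVd TW hW hWd hW2 hTW2 H hH ν (H.inv_mem hγ) Ψ)
    (fun Ψ => tsum_eisTerm_omega_ratThetaLiftCont F (adelicGram F e TV TW) (isUnit_det_adelicGram F e hVd hWd) H P hP (H.inv_mem hγ) Ψ)
    EI EE κ₀ hI hE

include hTW2 hH hP in
/-- **THE (INV-E″) LETTER, THETA SIDE DISCHARGED**: at `EI := thetaOrbitFunctional ν` and `κ₀ := ν(univ)` the structure identity `hI` is ★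
`doubledThetaIntegral_eq_measure_mul_apply_zero_add_thetaOrbitFunctional`, so only the (E_X)/(T1) letter `hE` remains a binder:
`(Λ_θ − ν(univ) • EE) ∘ ω(r⁻¹) = Λ_θ − ν(univ) • EE` for `r := u₀ · r_F(δ γ δ⁻¹) · u₀⁻¹`, `γ ∈ H`.
[cite: Weil1965, n° 41 and n° 51–52 Thm 5] [cite: Weil1964, Chap. III n° 41 Thm 6 p. 193] -/
theorem thetaOrbitFunctional_sub_smul_comp_omega_inv_conj_eq
    [LocallyCompactSpace (UnitaryGroup.adelic F E c N (TV.map (algebraMap F E)))]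
    [CompactSpace (UnitaryGroup.adelic F E c N (TV.map (algebraMap F E)) ⧸ (UnitaryGroup.toAdelic F E c N (TV.map (algebraMap F E))).range)]
    [BorelSpace (UnitaryGroup.adelic F E c N (TV.map (algebraMap F E)) ⧸ (UnitaryGroup.toAdelic F E c N (TV.map (algebraMap F E))).range)]
    [IsFiniteMeasure ν]
    (u₀ : adelicMpCont F (Fin (n + n)) (doubledGramFin F (adelicGram F e TV TW)))
    (hu₀ : ∀ Φ : piSchwartzBruhat F (Fin (n + n)),
      ((adelicMpCont.omega F (Fin (n + n)) (doubledGramFin F (adelicGram F e TV TW)) u₀ Φ : piSchwartzBruhat F (Fin (n + n))) :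
          (Fin (n + n) → AdeleRing (𝓞 F) F) → ℂ) =
        chirp F (ratMatrix F (frameHalfRat F)) (Φ : (Fin (n + n) → AdeleRing (𝓞 F) F) → ℂ))
    {γ : Matrix.symplecticGroup (Fin (n + n)) F} (hγ : γ ∈ H)
    (EE : piSchwartzBruhat F (Fin (n + n)) →ₗ[ℂ] ℂ)
    (hE : ∀ Ψ : piSchwartzBruhat F (Fin (n + n)),
      ∑' q : H ⧸ P.subgroupOf H,
        ((adelicMpCont.omega F (Fin (n + n)) (doubledGramFin F (adelicGram F e TV TW))
            (doublingDeltaLift F (adelicGram F e TV TW) (isUnit_det_adelicGram F e hVd hWd))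
            (adelicMpCont.omega F (Fin (n + n)) (doubledGramFin F (adelicGram F e TV TW))
              (ratThetaLiftCont F (doubledGramFin F (adelicGram F e TV TW))
                (isUnit_det_doubledGramFin F _ (isUnit_det_adelicGram F e hVd hWd))
                ((Quotient.out q : H) : Matrix.symplecticGroup (Fin (n + n)) F)⁻¹) Ψ) :
            piSchwartzBruhat F (Fin (n + n))) : (Fin (n + n) → AdeleRing (𝓞 F) F) → ℂ) 0 =
        ((geomFrame F (adelicGram F e TV TW) (isUnit_det_adelicGram F e hVd hWd) Ψ : piSchwartzBruhat F (Fin (n + n))) :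
            (Fin (n + n) → AdeleRing (𝓞 F) F) → ℂ) 0 +
          EE (geomFrame F (adelicGram F e TV TW) (isUnit_det_adelicGram F e hVd hWd) Ψ)) :
    (thetaOrbitFunctional F E c hcδ hδ hd N e TV hV hVd TW hW hWd ν - ((ν Set.univ).toReal : ℂ) • EE) ∘ₗ
        adelicMpCont.omega F (Fin (n + n)) (doubledGramFin F (adelicGram F e TV TW))
          (u₀ * ratThetaLiftCont F (doubledGramFin F (adelicGram F e TV TW))
              (isUnit_det_doubledGramFin F _ (isUnit_det_adelicGram F e hVd hWd))
              (doublingDeltaRat F * γ * (doublingDeltaRat F)⁻¹) * u₀⁻¹)⁻¹ =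
      thetaOrbitFunctional F E c hcδ hδ hd N e TV hV hVd TW hW hWd ν - ((ν Set.univ).toReal : ℂ) • EE :=
  sub_smul_comp_omega_inv_conj_eq F E c hcδ hδ hd N e TV hV hVd TW hW hWd hW2 hTW2 H P hH hP ν u₀ hu₀ hγ _ EE _
    (doubledThetaIntegral_eq_measure_mul_apply_zero_add_thetaOrbitFunctional F E c hcδ hδ hd N e TV hV hVd TW hW hWd ν) hE

end DualPair

/-! ## §3 The hypothesis `hH` for the child's `ratDoubledW` (membership ⇒ a rational witness `w`) -/

section Witness

variable (F E : Type) [Field F] [NumberField F] [Field E] [NumberField E] [Algebra F E] [Algebra.IsQuadraticExtension F E]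
  (c : E ≃ₐ[F] E) {δ : E} (hcδ : c δ = -δ) (hδ : δ ≠ 0) {d : F} (hd : δ * δ = algebraMap F E d)
  (N : ℕ) {n : ℕ} (e : Fin N × Fin 1 ≃ Fin n)
  (TV : Matrix (Fin N) (Fin N) F) (hV : TV.IsSymm) (hVd : IsUnit TV.det)
  (TW : Matrix (Fin 1) (Fin 1) F) (hW : TW.IsSymm) (hWd : IsUnit TW.det)
  {TW2 : Matrix (Fin (1 + 1)) (Fin (1 + 1)) F} (hW2 : TW2.IsSymm)

/-- **`hH` for the child's `IW = ratDoubledW`**: membership of `γ` in `comap ratSpAut (range ratWToAut)` (unfolded: the two maps into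
`Aut(𝕎□_𝔸)` are the subgroup inclusions composed with `ratSp` resp. `ι_{eD} ∘ adelicInr ∘ toAdelic`) yields a rational `w` with
`ι_{eD}(1 ⊗ w) = ratSp γ` as automorphisms of `𝕎□_𝔸`. [cite: GelbartPiatetskishapiroRallis1987, Part A §2 pp. 7–9] -/
theorem exists_witness_of_mem_comap_range {γ : Matrix.symplecticGroup (Fin (n + n)) F}
    (hγ : γ ∈ Subgroup.comap
        ((symplecticGroup (polar (adelicForm F (Fin (n + n)) (doubledGramFin F (adelicGram F e TV TW))))).subtype.comp
          (ratSp F (doubledGramFin F (adelicGram F e TV TW)) (isUnit_det_doubledGramFin F _ (isUnit_det_adelicGram F e hVd hWd))))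
        (MonoidHom.range
          ((symplecticGroup (polar (adelicForm F (Fin (n + n))
              (adelicGram F
                (((Equiv.prodCongr (Equiv.refl (Fin N)) finSumFinEquiv.symm).trans (Equiv.prodSumDistrib (Fin N) (Fin 1) (Fin 1))).trans
                  ((Equiv.sumCongr e e).trans finSumFinEquiv)) TV TW2)))).subtype.comp
            ((toSp F E c N (1 + 1)
                (((Equiv.prodCongr (Equiv.refl (Fin N)) finSumFinEquiv.symm).trans (Equiv.prodSumDistrib (Fin N) (Fin 1) (Fin 1))).trans
                  ((Equiv.sumCongr e e).trans finSumFinEquiv))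
                (TV.map (algebraMap F E)) (TW2.map (algebraMap F E)) hcδ hδ hd hV hW2 rfl rfl).comp
              ((UnitaryGroup.adelicInr F E c N (1 + 1) (TV.map (algebraMap F E)) (TW2.map (algebraMap F E))).comp
                (UnitaryGroup.toAdelic F E c (1 + 1) (TW2.map (algebraMap F E)))))))) :
    ∃ w : UnitaryGroup.rational F E c (1 + 1) (TW2.map (algebraMap F E)),
      ((toSp F E c N (1 + 1)
            (((Equiv.prodCongr (Equiv.refl (Fin N)) finSumFinEquiv.symm).trans (Equiv.prodSumDistrib (Fin N) (Fin 1) (Fin 1))).trans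
              ((Equiv.sumCongr e e).trans finSumFinEquiv))
            (TV.map (algebraMap F E)) (TW2.map (algebraMap F E)) hcδ hδ hd hV hW2 rfl rfl
            (UnitaryGroup.adelicInr F E c N (1 + 1) (TV.map (algebraMap F E)) (TW2.map (algebraMap F E))
              (UnitaryGroup.toAdelic F E c (1 + 1) (TW2.map (algebraMap F E)) w)) :
            symplecticGroup (polar (adelicForm F (Fin (n + n))
              (adelicGram F
                (((Equiv.prodCongr (Equiv.refl (Fin N)) finSumFinEquiv.symm).trans (Equiv.prodSumDistrib (Fin N) (Fin 1) (Fin 1))).trans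
                  ((Equiv.sumCongr e e).trans finSumFinEquiv)) TV TW2)))) :
          ((Fin (n + n) → AdeleRing (𝓞 F) F) × (Fin (n + n) → AdeleRing (𝓞 F) F)) ≃ₗ[AdeleRing (𝓞 F) F]
            ((Fin (n + n) → AdeleRing (𝓞 F) F) × (Fin (n + n) → AdeleRing (𝓞 F) F))) =
        ((ratSp F (doubledGramFin F (adelicGram F e TV TW))
            (isUnit_det_doubledGramFin F _ (isUnit_det_adelicGram F e hVd hWd)) γ :
            symplecticGroup (polar (adelicForm F (Fin (n + n)) (doubledGramFin F (adelicGram F e TV TW))))) :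
          ((Fin (n + n) → AdeleRing (𝓞 F) F) × (Fin (n + n) → AdeleRing (𝓞 F) F)) ≃ₗ[AdeleRing (𝓞 F) F]
            ((Fin (n + n) → AdeleRing (𝓞 F) F) × (Fin (n + n) → AdeleRing (𝓞 F) F))) := by
  obtain ⟨w, hw⟩ := Subgroup.mem_comap.mp hγ
  exact ⟨w, hw⟩

end Witness

/-! ## §4 (ED. 2) THE LETTER WITH NO STRUCTURE BINDER: `(Λ_θ − ν(univ) • E_X^ℂ) ∘ ω(r⁻¹) = Λ_θ − ν(univ) • E_X^ℂ` -/

section Unconditional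

variable (F E : Type) [Field F] [NumberField F] [Field E] [NumberField E] [Algebra F E] [Algebra.IsQuadraticExtension F E]
  (c : E ≃ₐ[F] E) {δ : E} (hcδ : c δ = -δ) (hδ : δ ≠ 0) {d : F} (hd : δ * δ = algebraMap F E d)
  (N : ℕ) {n : ℕ} (e : Fin N × Fin 1 ≃ Fin n)
  (TV : Matrix (Fin N) (Fin N) F) (hV : TV.IsSymm) (hVd : IsUnit TV.det)
  (TW : Matrix (Fin 1) (Fin 1) F) (hW : TW.IsSymm) (hWd : IsUnit TW.det)

/-- **THE (INV-E″) LETTER, UNCONDITIONAL (CM ∕ totally real, `2 < N`)**: with `EI := Λ_θ = thetaOrbitFunctional ν`, `κ₀ := ν([U(J_V)])` and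
`EE := adelicSiegelFunctionalC νX q_{C₀} … hB` (the complexified Eisenstein fibre functional at the closed rational form `C₀ = 𝕋_F ⊕ (−d 𝕋_F⁻¹)`,
Tamagawa `νX`, condition (B) `hB`), for every rational point `γ ∈ IW(F)` of the doubled `W`-member (the child's `ratDoubledW`, unfolded) and A-p12's
frame pair `u₀`: `(EI − κ₀ • EE) ∘ ω((u₀ · r_F(δ γ δ⁻¹) · u₀⁻¹)⁻¹) = EI − κ₀ • EE` — `§2` with the (E_X)/(T1) structure letter `hE` DISCHARGED by ★
`E2SWEisStructure.eis_eq_geomFrame_zero_add_adelicSiegelFunctionalC` and `hH`/`hP` by `§3` ∕ ★ `DoublingFrame.mem_siegelParabolicPi_of_mem_comap_conj`.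
[cite: Weil1965, n° 41 and n° 51–52 Thm 5] [cite: Weil1964, Chap. III n° 41 Thm 6 p. 193] -/
theorem thetaOrbitFunctional_sub_smul_adelicSiegelFunctionalC_comp_omega_inv_conj_eq [IsTotallyReal F]
    [LocallyCompactSpace (UnitaryGroup.adelic F E c N (TV.map (algebraMap F E)))]
    [LocallyCompactSpace (UnitaryGroup.adelic F E c 1 (TW.map (algebraMap F E)))]
    (s : UnitaryGroup.adelicPair F E c N 1 (TV.map (algebraMap F E)) (TW.map (algebraMap F E)) →*
      adelicMpCont F (Fin n) (adelicGram F e TV TW))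
    (hs : (splittingDatum F E c N 1 e (TV.map (algebraMap F E)) (TW.map (algebraMap F E)) hcδ hδ hd hV hW hVd hWd rfl rfl).IsCompatible s)
    (hN : 2 < N)
    [CompactSpace (UnitaryGroup.adelic F E c N (TV.map (algebraMap F E)) ⧸ (UnitaryGroup.toAdelic F E c N (TV.map (algebraMap F E))).range)]
    [MeasurableSpace (UnitaryGroup.adelic F E c N (TV.map (algebraMap F E)) ⧸ (UnitaryGroup.toAdelic F E c N (TV.map (algebraMap F E))).range)]
    [BorelSpace (UnitaryGroup.adelic F E c N (TV.map (algebraMap F E)) ⧸ (UnitaryGroup.toAdelic F E c N (TV.map (algebraMap F E))).range)]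
    (ν : Measure (UnitaryGroup.adelic F E c N (TV.map (algebraMap F E)) ⧸ (UnitaryGroup.toAdelic F E c N (TV.map (algebraMap F E))).range))
    [IsFiniteMeasure ν]
    [MeasurableSpace (adeleQuotient F)] [BorelSpace (adeleQuotient F)]
    [MeasurableSpace (AdeleRing (𝓞 F) F)] [BorelSpace (AdeleRing (𝓞 F) F)]
    (νX : Measure (Fin (n + n) → AdeleRing (𝓞 F) F)) [νX.IsAddHaarMeasure] (hνX : νX (piFundamentalDomain F (Fin (n + n))) = 1)
    (hB : ∀ Φ ∈ piSchwartzBruhat F (Fin (n + n)),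
      Summable fun ξ : F => ‖adelicSiegelCoeff F (Fin (n + n)) νX (sdForm F (Literature.NumberTheory.Weil1964.ratMatrix F (Matrix.reindex finSumFinEquiv finSumFinEquiv (Matrix.fromBlocks (gram F e TV TW) 0 0 (-(d • (gram F e TV TW)⁻¹)))))) Φ ξ‖)
    (u₀ : adelicMpCont F (Fin (n + n)) (doubledGramFin F (adelicGram F e TV TW)))
    (hu₀ : ∀ Φ : piSchwartzBruhat F (Fin (n + n)),
      ((adelicMpCont.omega F (Fin (n + n)) (doubledGramFin F (adelicGram F e TV TW)) u₀ Φ : piSchwartzBruhat F (Fin (n + n))) :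
          (Fin (n + n) → AdeleRing (𝓞 F) F) → ℂ) =
        chirp F (ratMatrix F (frameHalfRat F)) (Φ : (Fin (n + n) → AdeleRing (𝓞 F) F) → ℂ))
    {γ : Matrix.symplecticGroup (Fin (n + n)) F} (hγ : γ ∈ (((symplecticGroup (polar (adelicForm F (Fin (n + n)) (adelicGram F (((Equiv.prodCongr (Equiv.refl (Fin N)) finSumFinEquiv.symm).trans (Equiv.prodSumDistrib (Fin N) (Fin 1) (Fin 1))).trans ((Equiv.sumCongr e e).trans finSumFinEquiv)) TV (Matrix.reindex finSumFinEquiv finSumFinEquiv (Matrix.fromBlocks TW 0 0 (-TW))))))).subtype.comp ((toSp F E c N (1 + 1) (((Equiv.prodCongr (Equiv.refl (Fin N)) finSumFinEquiv.symm).trans (Equiv.prodSumDistrib (Fin N) (Fin 1) (Fin 1))).trans ((Equiv.sumCongr e e).trans finSumFinEquiv)) (TV.map (algebraMap F E)) ((Matrix.reindex finSumFinEquiv finSumFinEquiv (Matrix.fromBlocks TW 0 0 (-TW))).map (algebraMap F E)) hcδ hδ hd hV (E2SWOrbit.twd_isSymm F TW hW) rfl rfl).comp ((UnitaryGroup.adelicInr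 F E c N (1 + 1) (TV.map (algebraMap F E)) ((Matrix.reindex finSumFinEquiv finSumFinEquiv (Matrix.fromBlocks TW 0 0 (-TW))).map (algebraMap F E))).comp (UnitaryGroup.toAdelic F E c (1 + 1) ((Matrix.reindex finSumFinEquiv finSumFinEquiv (Matrix.fromBlocks TW 0 0 (-TW))).map (algebraMap F E)))))).range.comap ((symplecticGroup (polar (adelicForm F (Fin (n + n)) (doubledGramFin F (adelicGram F e TV TW))))).subtype.comp (ratSp F (doubledGramFin F (adelicGram F e TV TW)) (isUnit_det_doubledGramFin F _ (isUnit_det_adelicGram F e hVd hWd)))))) :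
    (thetaOrbitFunctional F E c hcδ hδ hd N e TV hV hVd TW hW hWd ν -
          ((ν Set.univ).toReal : ℂ) •
            adelicSiegelFunctionalC F (Fin (n + n)) νX (sdForm F (Literature.NumberTheory.Weil1964.ratMatrix F (Matrix.reindex finSumFinEquiv finSumFinEquiv (Matrix.fromBlocks (gram F e TV TW) 0 0 (-(d • (gram F e TV TW)⁻¹))))))
              (E2SWEisDecomposition.continuous_sdForm F _) hB) ∘ₗ
        adelicMpCont.omega F (Fin (n + n)) (doubledGramFin F (adelicGram F e TV TW))
          (u₀ * ratThetaLiftCont F (doubledGramFin F (adelicGram F e TV TW))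
              (isUnit_det_doubledGramFin F _ (isUnit_det_adelicGram F e hVd hWd))
              (doublingDeltaRat F * γ * (doublingDeltaRat F)⁻¹) * u₀⁻¹)⁻¹ =
      thetaOrbitFunctional F E c hcδ hδ hd N e TV hV hVd TW hW hWd ν -
        ((ν Set.univ).toReal : ℂ) •
          adelicSiegelFunctionalC F (Fin (n + n)) νX (sdForm F (Literature.NumberTheory.Weil1964.ratMatrix F (Matrix.reindex finSumFinEquiv finSumFinEquiv (Matrix.fromBlocks (gram F e TV TW) 0 0 (-(d • (gram F e TV TW)⁻¹))))))
            (E2SWEisDecomposition.continuous_sdForm F _) hB :=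
  thetaOrbitFunctional_sub_smul_comp_omega_inv_conj_eq F E c hcδ hδ hd N e TV hV hVd TW hW hWd (TW2 := (Matrix.reindex finSumFinEquiv finSumFinEquiv (Matrix.fromBlocks TW 0 0 (-TW))))
    (E2SWOrbit.twd_isSymm F TW hW) rfl (((symplecticGroup (polar (adelicForm F (Fin (n + n)) (adelicGram F (((Equiv.prodCongr (Equiv.refl (Fin N)) finSumFinEquiv.symm).trans (Equiv.prodSumDistrib (Fin N) (Fin 1) (Fin 1))).trans ((Equiv.sumCongr e e).trans finSumFinEquiv)) TV (Matrix.reindex finSumFinEquiv finSumFinEquiv (Matrix.fromBlocks TW 0 0 (-TW))))))).subtype.comp ((toSp F E c N (1 + 1) (((Equiv.prodCongr (Equiv.refl (Fin N)) finSumFinEquiv.symm).trans (Equiv.prodSumDistrib (Fin N) (Fin 1) (Fin 1))).trans ((Equiv.sumCongr e e).trans finSumFinEquiv)) (TV.map (algebraMap F E)) ((Matrix.reindex finSumFinEquiv finSumFinEquiv (Matrix.fromBlocks TW 0 0 (-TW))).map (algebraMap F E)) hcδ hδ hd hV (E2SWOrbit.twd_isSymm F TW hW) rfl rfl).comp ((UnitaryGroup.adelicInr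 F E c N (1 + 1) (TV.map (algebraMap F E)) ((Matrix.reindex finSumFinEquiv finSumFinEquiv (Matrix.fromBlocks TW 0 0 (-TW))).map (algebraMap F E))).comp (UnitaryGroup.toAdelic F E c (1 + 1) ((Matrix.reindex finSumFinEquiv finSumFinEquiv (Matrix.fromBlocks TW 0 0 (-TW))).map (algebraMap F E)))))).range.comap ((symplecticGroup (polar (adelicForm F (Fin (n + n)) (doubledGramFin F (adelicGram F e TV TW))))).subtype.comp (ratSp F (doubledGramFin F (adelicGram F e TV TW)) (isUnit_det_doubledGramFin F _ (isUnit_det_adelicGram F e hVd hWd))))) (((siegelParabolicPi (doubledGramFin F (adelicGram F e TV TW))).comap (ratSp F (doubledGramFin F (adelicGram F e TV TW)) (isUnit_det_doubledGramFin F _ (isUnit_det_adelicGram F e hVd hWd)))).comap (MulAut.conj (doublingDeltaRat F (n := n))).toMonoidHom)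
    (fun _ hγ' => exists_witness_of_mem_comap_range F E c hcδ hδ hd N e TV hV hVd TW hWd (E2SWOrbit.twd_isSymm F TW hW) hγ')
    (fun _ hp => DoublingFrame.mem_siegelParabolicPi_of_mem_comap_conj F (adelicGram F e TV TW) (isUnit_det_adelicGram F e hVd hWd) hp)
    ν u₀ hu₀ hγ _
    (E2SWEisStructure.eis_eq_geomFrame_zero_add_adelicSiegelFunctionalC F E c N e hcδ hδ hd hV hW hVd hWd s hs hN νX hνX hB)

end Unconditional

end Summit.HodgeConjecture.HodgeConjecture.Cruxes.H413.E2SWEInvariance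

end
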